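import Summits.PneNP.PneNP.Theses.SzkEntropy
import Literature.Computability.MetaComplexity.DistProblems
import Literature.Computability.Complexity.BrickAlgebra
import Literature.Computability.Complexity.ReductionsProofs

/-!
# PneNP / SzkEntropy — crux `PeaWorstToAvg` (stmt-PneNP-10777): the `IsPolySamplable` conjunct admits advice

Route `PneNP/SzkEntropy`, crux #3, item stmt-PneNP-10777.  The crux concludes with an ensemble `D`
satisfying `D.IsPolySamplable` (`Literature/Computability/MetaComplexity/DistProblems.lean`), i.e.
`∃ A : RandAlg ℕ (List Bool), A.IsPolyTime unaryEncodeNat id ∧ ∀ n, A.outputPMF unaryEncodeNat n = D n`.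
This file machine-checks a READING CAVEAT for that conjunct (first observed by the standing
disprover `refuter-cdisprove-stmt-PneNP-10777-0`, Disproof §5): the coin budget `coinLen` of a
`RandAlg` is only required to be BOUNDED by a polynomial (`RandAlg.IsPolyTime`:
`∃ p, ∀ n, coinLen n ≤ p.eval n`), not to be one, and the machine sees the coin string it is handed,
so `coinLen` acts as (logarithmically many bits of) non-uniform advice.  Concretely:

* `isPolySamplable_pure_singleton` — for EVERY function `a : ℕ → Bool`, computable or not, the
  point-mass ensemble `n ↦ δ_{[a n]}` is `IsPolySamplable` (sampler: `coinLen n := if a n then 1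
  else 0`, output `[r ≠ []]` — a four-line `FP` brick composition, no coin is ever read for its
  value);
* `not_countable_PSamp` — hence the tree's class `PSamp` of "polynomial-time samplable" ensembles
  is UNCOUNTABLE (Cantor diagonal over `a`), whereas genuinely uniformly samplable ensembles are
  countably many (one per probabilistic machine).

Consequences for the crux (see the prover status note on the item): the `∃ D` of `PeaWorstToAvg`
ranges over advice-samplers and `HeurBPP` schemes likewise receive `coinLen`-advice, while the
hypothesis `PEA 3 ∉ PromiseBPP'` is uniform; believed harmless for the truth value, but every
reduction that SIMULATES a given scheme or sampler must obtain its exact coin count (advice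
elimination by labelled self-testing, or length normalisation), and a root repair would pin
`coinLen` to a polynomial in `Randomized.lean`.

References: A. Bogdanov, L. Trevisan, *Average-Case Complexity* (2006), Def. 2.1 (`PSamp`);
S. Arora, B. Barak, *Computational Complexity* (2009), Def. 7.1–7.3 (coins of a PTM) and §6.3
(advice); O. Goldreich, *Foundations of Cryptography I* (2001), §1.3.3 (non-uniformity as advice).
-/

namespace Summit.PneNP.PneNP.Theorems

open Literature.Computability.Complexity Literature.Computability.MetaComplexity
open Literature.Computability.Complexity.Brick
open _root_.Computability

/-- **Every Boolean sequence is "polynomial-time samplable" as a point-mass ensemble.** For every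
`a : ℕ → Bool` (no computability assumed) the ensemble `n ↦ δ_{[a n]}` satisfies
`Ensemble.IsPolySamplable`: take the sampler with coin budget `coinLen n := if a n then 1 else 0`
(bounded by the constant polynomial `1`) whose machine outputs the single bit "my coin string is
non-empty" (`notFn (isNilFn ∘ sndF) ∈ FP`); on `1ⁿ` it receives `1` coin iff `a n`, so its output
is `[a n]` with probability one.  The bit `a n` is smuggled in through the LENGTH of the coin
string — the advice leak of `RandAlg.IsPolyTime`. [BogdanovTrevisan2006, Def. 2.1 (the intended,
uniform notion); AroraBarakCC2009, §6.3 (advice)] -/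
theorem isPolySamplable_pure_singleton (a : ℕ → Bool) :
    Ensemble.IsPolySamplable (fun n => PMF.pure [a n]) := by
  -- the sampler
  let A : RandAlg ℕ (List Bool) :=
    { run := fun _ r => [decide (r ≠ [])]
      coinLen := fun n => if a n then 1 else 0 }
  -- its run map, read through the pairing, is an `FP` brick
  have hg : notFn (isNilFn ∘ sndF) ∈ FP :=
    notFn_mem_FP (comp_mem_FP isNilFn_mem_FP sndF_mem_FP)
  have hg_apply : ∀ (u r : List Bool),
      notFn (isNilFn ∘ sndF) (boolPair u r) = [decide (r ≠ [])] := by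
    intro u r
    have hc : (isNilFn ∘ sndF) (boolPair u r) = [decide (r = [])] := by
      simp [isNilFn]
    rw [notFn_apply hc]
    simp
  -- the unary code of `m` has length `m` (proved in many tree files, always privately)
  have hlenU : ∀ m : ℕ, (unaryEncodeNat m).length = m := by
    intro m
    induction m with
    | zero => rfl
    | succ m ih => simp [unaryEncodeNat, ih]
  refine ⟨A, ⟨?_, ⟨1, fun n => ?_⟩⟩, fun n => ?_⟩
  · -- polynomial time: the same machine, re-indexed along the input encoder
    obtain ⟨p, M, hM⟩ := hg
    refine ⟨p, M, fun q => ?_⟩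
    have h := hM (boolPair (unaryEncodeNat q.1) q.2)
    rw [hg_apply] at h
    exact h
  · -- coin budget bounded by the constant polynomial 1
    show (if a n then 1 else 0) ≤ (1 : Polynomial ℕ).eval n
    split_ifs <;> simp
  · -- output distribution: the run map is constant `[a n]` on coin strings of the prescribed length
    show (PMF.uniformOfFintype
        (List.Vector Bool (A.coinLen (unaryEncodeNat n).length))).map
          (fun r => A.run n r.toList) = PMF.pure [a n]
    have hconst : (fun r : List.Vector Bool (A.coinLen (unaryEncodeNat n).length) =>
        A.run n r.toList) = fun _ => [a n] := by
      funext r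
      have hlen : r.toList.length = (if a n then 1 else 0) := by
        rw [List.Vector.toList_length, hlenU]
      show [decide (r.toList ≠ [])] = [a n]
      cases ha : a n
      · have h0 : r.toList.length = 0 := by
          rw [hlen]
          simp [ha]
        have h1 : r.toList = [] := List.length_eq_zero_iff.1 h0
        simp [h1]
      · have h0 : r.toList.length = 1 := by
          rw [hlen]
          simp [ha]
        have hne : r.toList ≠ [] := by
          intro h2
          rw [h2] at h0
          exact absurd h0 (by decide)
        simp [hne]
    rw [hconst]
    exact PMF.map_const _ _

/-- **`PSamp` is uncountable.** The class `PSamp = {D | D.IsPolySamplable}` of the tree contains the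
injective image `a ↦ (n ↦ δ_{[a n]})` of ALL of `ℕ → Bool` (`isPolySamplable_pure_singleton`), so it
is not countable (Cantor's diagonal argument) — although there are only countably many
probabilistic polynomial-time machines: the definition quantifies over arbitrary coin-budget
functions, which act as advice. [BogdanovTrevisan2006, Def. 2.1; AroraBarakCC2009, §6.3] -/
theorem not_countable_PSamp : ¬ (PSamp : Set Ensemble).Countable := by
  intro hcount
  -- the injective family of advice ensembles
  let Φ : (ℕ → Bool) → Ensemble := fun a n => PMF.pure [a n]
  have hΦ : Function.Injective Φ := by
    intro a b hab
    funext n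
    have h1 : Φ a n [a n] = Φ b n [a n] := by rw [hab]
    have h2 : (PMF.pure [b n] : PMF (List Bool)) [a n] = 1 := by
      rw [← show Φ b n = PMF.pure [b n] from rfl, ← h1]
      exact PMF.pure_apply_self _
    by_contra hne
    have hne' : [a n] ≠ [b n] := fun h => hne (List.singleton_injective h)
    rw [PMF.pure_apply_of_ne _ _ hne'] at h2
    exact zero_ne_one h2
  have hrange : Set.range Φ ⊆ PSamp := by
    rintro _ ⟨a, rfl⟩
    exact isPolySamplable_pure_singleton a
  have hc : (Set.range Φ).Countable := hcount.mono hrange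
  haveI : Countable (Set.range Φ) := hc.to_subtype
  have hinj : Function.Injective (fun a : ℕ → Bool => (⟨Φ a, a, rfl⟩ : Set.range Φ)) :=
    fun a b h => hΦ (congrArg Subtype.val h)
  haveI : Countable (ℕ → Bool) := hinj.countable
  -- Cantor's diagonal
  obtain ⟨e, he⟩ := exists_surjective_nat (ℕ → Bool)
  obtain ⟨k, hk⟩ := he fun n => !(e n n)
  have h := congrFun hk k
  cases h' : e k k <;> simp [h'] at h

end Summit.PneNP.PneNP.Theorems
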